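import Summits.BirchSwinnertonDyer.Rank1Residual.GaloisImage.UnramifiedOrthogonalOfIsPerfect
import Summits.BirchSwinnertonDyer.Rank1Residual.Additive.UnramifiedKummerDisjoint
import Literature.NumberTheory.GaloisRepresentations.DiscreteModuleInverseLimitH1
import HarnessLib

/-!
# Milne *ADT* I Thm. 2.6 WITHOUT the unramified-module hypothesis: at every finite place `v ∤ n` the
# unramified classes `H¹_ur(K_v, M)` and `H¹_ur(K_v, M^D)` are EXACT annihilators of each other, for
# EVERY finite `n`-torsion `Γ_K`-module `M` (ramified at `v` or not), every perfect family, prime-power `n`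
# (route `KatoDescentPotSupersingular` / `…Tame…`, crux M = stmt-BirchSwinnertonDyer-19196; route-free helper)

Seat `bsd-potss-rkm` g17 (prover; cell `bsd-potss`), item stmt-BirchSwinnertonDyer-19196 `ReducibleKatoMember`
(`--supports … --as helper`; closes nothing).  HONEST FRAMING: BSD is not proved by any of this; nothing is booked;
theorems only (no definition, no named fact): TOOL theorems of local Galois cohomology.

## Why (the level-`0` Poitou–Tate count of crux M, FINDING-19196-rkm-g16 §«THE ROAD to M»)

Kato's group `S(T) = Ker(H¹(ℤ[1/p], T ⊗ ℚ/ℤ) → H¹(ℚ_p, T ⊗ ℚ/ℤ)/H¹_f)` (Astérisque 295, 14.8, p. 238) and his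
`H¹(ℤ[1/p], T)` are Selmer groups whose local condition at every prime `ℓ ≠ p` — the BAD primes of `E`
included — is the UNRAMIFIED condition `H¹_ur(ℚ_ℓ, ·) = Ker(H¹(ℚ_ℓ, ·) → H¹(I_ℓ, ·))` (§8.2, cohomology of
`j_*`; Lemma 8.5, p. 184).  To run the tree's pair-counting form of Poitou–Tate for Selmer structures
(`GaloisImage.card_selmerGroup_pair`) on the finite levels `E[p^k]` of these groups one must know the DUAL
local condition `(H¹_ur(ℚ_ℓ, E[p^k]))^*` at the bad primes `ℓ ≠ p`, where `E[p^k]` is RAMIFIED.  The tree's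
Milne I Thm. 2.6 (`LocalInvariants.UnramifiedOrthogonal`, PROVED from `IsPerfect` by n1011:
`GaloisImage.UnramifiedCup.unramifiedOrthogonal_of_isPerfect`) is stated, as in print, for `M` UNRAMIFIED
at `v`.  THIS FILE removes that hypothesis: for every finite discrete `n`-torsion `Γ_K`-module `M`, every
finite place `v ∤ n`, every PERFECT family `inv` at prime-power `n`,

  **`(H¹_ur(K_v, M))^* = H¹_ur(K_v, M^D)`** and **every class annihilating `H¹_ur(K_v, M^D)` is unramified**

(`dualLocalCondition_unramifiedSubgroup_eq`, `mem_unramifiedSubgroup_of_forall_pairing_eq_zero`).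

## Proof (Milne's counting argument; every input a tree theorem)

* ORTHOGONALITY at EVERY finite place (no hypothesis on `v`, `n`, or the inertia action):
  an unramified class has a representative cocycle VANISHING on the inertia group — it is principal
  there (`X11b.LocBridge.mem_unramifiedSubgroup_one_iff_exists`: `φ τ = τ w − w` on `I`), so subtract the
  principal cocycle of `w` (`principalCocycle`, class `0`) — and the cup product of two cocycles vanishing on
  `I = Gal(K̄_v/K_v^{nr})` is inflated from `H²(Γ_{K_v}/I, μₙ^I) = 0` (`cd(Ẑ) = 1`:
  `subsingleton_two_quotient_galUnr_of_finite`; `UnramifiedCup.cupClass_eq_zero_of_vanishing_of_subsingleton`).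
* EQUALITY by counting in the finite groups `H¹(K_v, M)`, `H¹(K_v, M^D)` (perfect pairing into `ℤ/n`):
  `#H¹_ur(X) = #H⁰(K_v, X)` for EVERY finite `X` (`Additive.natCard_unramifiedSubgroup_eq_natCard_invariants_general`,
  Milne I Lemma 2.9 without the unramified hypothesis), Tate's local Euler–Poincaré characteristic in the
  prime-to-residue-characteristic case `#H⁰(M)·#H²(M) = #H¹(M)` (`natCard_invariants_mul_natCard_two_eq`), the
  `(2,0)`-duality `#H²(K_v, M) = #H⁰(K_v, M^D)` (`natCard_two_eq_natCard_invariants_homRep`, `tateDualLocalIso`);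
  hence `#H¹(K_v, M^D) = #H¹_ur(M)·#H¹_ur(M^D)`, and an inclusion between subgroups of equal size is an equality
  (`X11b.FiniteDuality.natCard_annRight_mul`, `…annLeft_mul`).

So for prime-power `n` the unramified local condition is SELF-DUAL at every finite `v ∤ n`, which is what the
finite-level Poitou–Tate count of Kato's `S(T)` / `H¹(ℤ[1/p], T)` (sequel file) consumes at the bad primes.
(At `v ∣ n` the orthogonality still holds — proved here — but the equality fails in general.)

References: J. S. Milne, *Arithmetic Duality Theorems* (2006), I Thm. 2.6, Lemma 2.9, Thm. 2.8 [MilneADT2006];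
J.-P. Serre, *Galois Cohomology* (1997), I §5.1, II §5.5 [SerreGaloisCohomology1997]; K. Kato, Astérisque 295
(2004) §8.2, Lemma 8.5, 14.8 [Kato2004Asterisque]; B. Mazur, K. Rubin, Mem. AMS 799 (2004) §1.1–1.3 (the
`H¹_ur`/`H¹_f` distinction for ramified `T`) [MazurRubin2004].
-/

-- the summit and its single problem are both named `BirchSwinnertonDyer` (registry layout D-0017)
set_option linter.dupNamespace false
set_option autoImplicit false

noncomputable section

open CategoryTheory Function
open scoped ContRepresentation NumberField

universe u

namespace Summit.BirchSwinnertonDyer.BirchSwinnertonDyer.Theorems.UnramifiedSelfDual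

open Field ValuativeRel NumberField IsDedekindDomain
open Literature.NumberTheory.GaloisRepresentations
open Literature.NumberTheory.GaloisRepresentations.IsNonarchimedeanLocalField
open _root_.TopRep _root_.ContRepresentation _root_.ContinuousCohomology
open Literature.NumberTheory.GaloisCohomology
open Summit.BirchSwinnertonDyer.Rank1Residual
open Summit.BirchSwinnertonDyer.Rank1Residual.GaloisImage

/-! ## §1 Unramified classes have representatives vanishing on the inertia group (any local field, any module) -/

section Representative

variable {F : Type u} [Field F] [ValuativeRel F] [TopologicalSpace F] [IsNonarchimedeanLocalField F]
  {W : Type u} [AddCommGroup W] [TopologicalSpace W] [DiscreteTopology W] (ρ : DiscreteGaloisModule F W)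

/-- **An unramified class is represented by a cocycle VANISHING on the inertia group**, for EVERY discrete
`Γ_F`-module `W` (no hypothesis on the inertia action): if `[φ] ∈ H¹_ur(F, W)` then `φ` is principal on
`I_F`, `φ τ = τ w − w` (`X11b.LocBridge.mem_unramifiedSubgroup_one_iff_exists`), and `φ − (g ↦ g w − w)` is a
cocycle in the same class vanishing on `I_F`.  [cite: MilneADT2006, Ch. I §2 (unramified cohomology)]
[cite: SerreGaloisCohomology1997, I §5.1] -/
theorem exists_cocycle_eq_zero_on_inertia_of_mem_unramifiedSubgroup
    {a : galoisCohomology ρ 1} (ha : a ∈ DiscreteGaloisModule.unramifiedSubgroup ρ 1) :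
    ∃ f : contOneCocycles ρ.toTopRep, oneCocycleClass ρ.toTopRep f = a ∧ ∀ τ ∈ absInertia F, f.1 τ = 0 := by
  obtain ⟨φ, rfl⟩ := oneCocycleClass_surjective ρ.toTopRep a
  obtain ⟨w, hw⟩ := (X11b.LocBridge.mem_unramifiedSubgroup_one_iff_exists ρ φ).1 ha
  refine ⟨φ - principalCocycle ρ w, ?_, fun τ hτ => ?_⟩
  · rw [oneCocycleClass_sub, oneCocycleClass_principalCocycle, sub_zero]
  · change φ.1 τ - (principalCocycle ρ w).1 τ = 0
    rw [principalCocycle_apply, hw τ hτ]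
    exact sub_self _

end Representative

/-! ## §2 Orthogonality `⟨H¹_ur(K_v, M), H¹_ur(K_v, M^D)⟩_v = 0` at EVERY finite place, for EVERY module -/

section Orthogonal

variable {K : Type u} [Field K] [NumberField K] {M : Type u} [AddCommGroup M] [TopologicalSpace M]
  [DiscreteTopology M] [Finite M] (ρ : DiscreteGaloisModule K M) (n : ℕ) [NeZero n]
  (v : HeightOneSpectrum (𝓞 K))

/-- **Unramified classes cup to zero, with NO hypothesis on the inertia action** (orthogonality half of
Milne I Thm. 2.6 for an arbitrary finite discrete `Γ_K`-module `M` at an arbitrary finite place `v`): for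
`a ∈ H¹_ur(K_v, M)`, `b ∈ H¹_ur(K_v, M^D)`, `a ∪ b = 0` in `H²(K_v, μₙ)`.  Representatives vanishing on
`I = Gal(K̄_v/K_v^{nr})` (§1) and `H²(Γ_{K_v}/I, μₙ^I) = 0` (`subsingleton_two_quotient_galUnr_of_finite`,
`cd(Ẑ) = 1`) feed `UnramifiedCup.cupClass_eq_zero_of_vanishing_of_subsingleton`; the tree's
`UnramifiedCup.localTatePairing_eq_zero_of_mem_unramifiedSubgroup` is the case of trivial inertia action on
`M` and `M^D`. [cite: MilneADT2006, Ch. I, Thm. 2.6] -/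
theorem localTatePairing_eq_zero_of_mem_unramifiedSubgroup
    {a : galoisCohomology (GaloisRep.toLocal v ρ) 1}
    (ha : a ∈ DiscreteGaloisModule.unramifiedSubgroup (GaloisRep.toLocal v ρ) 1)
    {b : galoisCohomology (GaloisRep.toLocal v (ρ.tateDual n)) 1}
    (hb : b ∈ DiscreteGaloisModule.unramifiedSubgroup (GaloisRep.toLocal v (ρ.tateDual n)) 1) :
    DiscreteGaloisModule.localTatePairing ρ n (Sum.inr v) a b = 0 := by
  classical
  haveI := absoluteGaloisGroup_compactSpace (v.adicCompletion K)
  obtain ⟨f, rfl, hf⟩ := exists_cocycle_eq_zero_on_inertia_of_mem_unramifiedSubgroup _ ha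
  obtain ⟨g, rfl, hg⟩ := exists_cocycle_eq_zero_on_inertia_of_mem_unramifiedSubgroup _ hb
  -- `H²(Γ/I, μₙ^I) = 0` (`cd(Ẑ) = 1`)
  haveI : Finite (DiscreteGaloisModule.MuCarrier K n) := finite_muCarrier (F := K) n
  haveI : Subsingleton (continuousCohomology 2
      ((GaloisRep.toLocal v (DiscreteGaloisModule.mu K n)).quotientInvariants
        (galUnr (v.adicCompletion K))).toTopRep) :=
    subsingleton_two_quotient_galUnr_of_finite (v.adicCompletion K) _ _
  change ContPairing.cupProduct (DiscreteGaloisModule.pairing (GaloisRep.toLocal v ρ)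
      (GaloisRep.toLocal v (ρ.tateDual n)) (GaloisRep.toLocal v (DiscreteGaloisModule.mu K n))
      (DiscreteGaloisModule.tateDualEval K M n)
      (fun _ m f => DiscreteGaloisModule.tateDualEval_smul ρ n _ m f))
      (oneCocycleClass _ f) (oneCocycleClass _ g) = 0
  rw [ContPairing.cupProduct_oneCocycleClass]
  refine UnramifiedCup.cupClass_eq_zero_of_vanishing_of_subsingleton (galUnr (v.adicCompletion K)) _ _ _ _
    f g (fun t ht => hf t ?_) (fun t ht => hg t ?_)
  · rw [← galUnr_eq_absInertia]; exact ht
  · rw [← galUnr_eq_absInertia]; exact ht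

/-- **`⟨a, b⟩_v = inv_v(a ∪ b) = 0` for unramified `a`, `b` and EVERY additive `inv_v`**, with no hypothesis
on the inertia action on `M`. [cite: MilneADT2006, Ch. I, Thm. 2.6] -/
theorem localTatePairingZMod_eq_zero_of_mem_unramifiedSubgroup
    (inv : galoisCohomology ((DiscreteGaloisModule.mu K n).toLocal (Sum.inr v)) 2 →+ ZMod n)
    {a : galoisCohomology (GaloisRep.toLocal v ρ) 1}
    (ha : a ∈ DiscreteGaloisModule.unramifiedSubgroup (GaloisRep.toLocal v ρ) 1)
    {b : galoisCohomology (GaloisRep.toLocal v (ρ.tateDual n)) 1}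
    (hb : b ∈ DiscreteGaloisModule.unramifiedSubgroup (GaloisRep.toLocal v (ρ.tateDual n)) 1) :
    DiscreteGaloisModule.localTatePairingZMod ρ n (Sum.inr v) inv a b = 0 := by
  rw [DiscreteGaloisModule.localTatePairingZMod_apply,
    localTatePairing_eq_zero_of_mem_unramifiedSubgroup ρ n v ha hb, map_zero]

/-- **`H¹_ur(K_v, M^D) ≤ (H¹_ur(K_v, M))^*` for EVERY family `inv : LocalInvariants K n`, EVERY finite
discrete `n`-torsion module `M` and EVERY finite place `v`** (the inclusion half of Milne I Thm. 2.6, clause 1,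
freed of the unramified-module hypothesis and of `v ∤ n`). [cite: MilneADT2006, Ch. I, Thm. 2.6] -/
theorem unramifiedSubgroup_tateDual_le_dualLocalCondition (inv : LocalInvariants K n) :
    DiscreteGaloisModule.unramifiedSubgroup (GaloisRep.toLocal v (ρ.tateDual n)) 1 ≤
      inv.dualLocalCondition ρ (Sum.inr v)
        (DiscreteGaloisModule.unramifiedSubgroup (GaloisRep.toLocal v ρ) 1) :=
  fun _ hb _ ha => localTatePairingZMod_eq_zero_of_mem_unramifiedSubgroup ρ n v _ ha hb

end Orthogonal

/-! ## §3 Milne I Thm. 2.6 for every finite `n`-torsion module at every `v ∤ n` (perfect family, prime-power `n`) -/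

section Main

variable {K : Type u} [Field K] [NumberField K] {n : ℕ}

open Summit.BirchSwinnertonDyer.Rank1Residual.X11b.FiniteDuality in
/-- **Milne, *ADT* I Thm. 2.6 WITHOUT the unramified hypothesis.**  For a PERFECT family `inv` of local
invariant maps at prime-power `n`, a finite discrete `Γ_K`-module `M` killed by `n` (ramified at `v` or not)
and a finite place `v ∤ n`: (1) the dual local condition of `H¹_ur(K_v, M)` IS `H¹_ur(K_v, M^D)`, and (2) every
class of `H¹(K_v, M)` annihilating `H¹_ur(K_v, M^D)` is unramified.  Orthogonality from §2; equality by COUNTING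
with the perfect pairing: `#H¹_ur(X) = #H⁰(K_v, X)` for every finite `X`
(`Additive.natCard_unramifiedSubgroup_eq_natCard_invariants_general`), `#H⁰(M)·#H²(M) = #H¹(M)`
(`natCard_invariants_mul_natCard_two_eq`, residue characteristic `∤ n`), `#H²(M) = #H⁰(M^D)`
(`natCard_two_eq_natCard_invariants_homRep`, `tateDualLocalIso`), `#H¹(M) = #H¹(M^D)` (perfectness).  The tree's
`UnramifiedCup.unramifiedOrthogonal_of_isPerfect` is the printed case `GaloisRep.IsUnramifiedAt v ρ`.
[cite: MilneADT2006, Ch. I, Thm. 2.6] [cite: SerreGaloisCohomology1997, II §5.5 and §5.7] -/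
theorem dualLocalCondition_unramifiedSubgroup_eq (inv : LocalInvariants K n) (hn : IsPrimePow n)
    (hperf : inv.IsPerfect) {M : Type u} [AddCommGroup M] [TopologicalSpace M] [DiscreteTopology M] [Finite M]
    (ρ : DiscreteGaloisModule K M) (hnM : ∀ m : M, n • m = 0)
    (v : HeightOneSpectrum (𝓞 K)) (hv : ((n : ℕ) : 𝓞 K) ∉ v.asIdeal) :
    inv.dualLocalCondition ρ (Sum.inr v)
          (DiscreteGaloisModule.unramifiedSubgroup (GaloisRep.toLocal v ρ) 1) =
        DiscreteGaloisModule.unramifiedSubgroup (GaloisRep.toLocal v (ρ.tateDual n)) 1 ∧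
      ∀ a : galoisCohomology (ρ.toLocal (Sum.inr v)) 1,
        (∀ b ∈ DiscreteGaloisModule.unramifiedSubgroup (GaloisRep.toLocal v (ρ.tateDual n)) 1,
            DiscreteGaloisModule.localTatePairingZMod ρ n (Sum.inr v) (inv (Sum.inr v)) a b = 0) →
          a ∈ DiscreteGaloisModule.unramifiedSubgroup (GaloisRep.toLocal v ρ) 1 := by
  classical
  obtain ⟨p, k, hp, hk, rfl⟩ := (isPrimePow_nat_iff _).1 hn
  haveI : Fact p.Prime := ⟨hp⟩
  haveI : NeZero (p ^ k) := ⟨pow_ne_zero k hp.ne_zero⟩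
  haveI := absoluteGaloisGroup_compactSpace (v.adicCompletion K)
  haveI : CharZero (v.adicCompletion K) := charZero_adicCompletion v
  haveI : Finite (DiscreteGaloisModule.TateDual K M (p ^ k)) :=
    DiscreteGaloisModule.TateDual.finite (K := K) (M := M) (p ^ k)
  have hpchar : p ≠ ringChar 𝓀[v.adicCompletion K] := by
    intro h
    apply UnramifiedCup.ringChar_residueField_not_dvd_of_not_mem (p ^ k) v hv
    rw [← h]
    exact dvd_pow_self p hk.ne'
  -- the two groups and the pairing, typed over `v.adicCompletion K`
  haveI hfinA : Finite (galoisCohomology (GaloisRep.toLocal v ρ) 1) :=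
    finite_galoisCohomology_one_of_isNonarchimedeanLocalField _
  haveI hfinB : Finite (galoisCohomology (GaloisRep.toLocal v (ρ.tateDual (p ^ k))) 1) :=
    finite_galoisCohomology_one_of_isNonarchimedeanLocalField _
  have hA : ∀ x : galoisCohomology (GaloisRep.toLocal v ρ) 1, (p ^ k) • x = 0 :=
    nsmul_continuousCohomology_one_eq_zero _ (p ^ k) hnM
  have hB : ∀ y : galoisCohomology (GaloisRep.toLocal v (ρ.tateDual (p ^ k))) 1, (p ^ k) • y = 0 :=
    nsmul_continuousCohomology_one_eq_zero _ (p ^ k) (TransverseCup.nsmul_tateDual_eq_zero (p ^ k) hnM)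
  let b : galoisCohomology (GaloisRep.toLocal v ρ) 1 →+
      galoisCohomology (GaloisRep.toLocal v (ρ.tateDual (p ^ k))) 1 →+ ZMod (p ^ k) :=
    DiscreteGaloisModule.localTatePairingZMod ρ (p ^ k) (Sum.inr v) (inv (Sum.inr v))
  have hb : Bijective b := ((hperf v).2 ρ hnM).1
  have hbf : Bijective b.flip := ((hperf v).2 ρ hnM).2
  -- the counts: `#H¹_ur = #H⁰` (Milne I Lemma 2.9, ANY module), `#H⁰(M)·#H²(M) = #H¹(M)` (EPC),
  -- `#H²(M) = #H⁰(M^D)` ((2,0)-duality), `#H¹(M) = #H¹(M^D)` (perfectness)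
  set X := DiscreteGaloisModule.unramifiedSubgroup (GaloisRep.toLocal v ρ) 1 with hXdef
  set Y := DiscreteGaloisModule.unramifiedSubgroup (GaloisRep.toLocal v (ρ.tateDual (p ^ k))) 1 with hYdef
  have hX : Nat.card X = Nat.card (GaloisRep.toLocal v ρ).toTopRep.ρ.invariants :=
    Additive.natCard_unramifiedSubgroup_eq_natCard_invariants_general (GaloisRep.toLocal v ρ)
  have hY : Nat.card Y = Nat.card (GaloisRep.toLocal v (ρ.tateDual (p ^ k))).toTopRep.ρ.invariants :=
    Additive.natCard_unramifiedSubgroup_eq_natCard_invariants_general (GaloisRep.toLocal v (ρ.tateDual (p ^ k)))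
  have hEPC := (natCard_invariants_mul_natCard_two_eq (v.adicCompletion K) (GaloisRep.toLocal v ρ)
    (ℓ := p) (fun m => ⟨k, hnM m⟩) hpchar).2
  have h20 := (natCard_two_eq_natCard_invariants_homRep (v.adicCompletion K) (GaloisRep.toLocal v ρ) hnM).2
  have hdual : Nat.card (GaloisRep.toLocal v (ρ.tateDual (p ^ k))).toTopRep.ρ.invariants =
      Nat.card ((GaloisRep.toLocal v ρ).homRep
        (DiscreteGaloisModule.mu (v.adicCompletion K) (p ^ k))).toTopRep.ρ.invariants :=
    Nat.card_congr (invariantsEquivOfIso (tateDualLocalIso v ρ (p ^ k)))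
  have hAB : Nat.card (galoisCohomology (GaloisRep.toLocal v ρ) 1) =
      Nat.card (galoisCohomology (GaloisRep.toLocal v (ρ.tateDual (p ^ k))) 1) :=
    natCard_eq_of_bijective hB b hb
  -- hence `#H¹(M^D) = #X · #Y`
  have hkey : Nat.card (galoisCohomology (GaloisRep.toLocal v (ρ.tateDual (p ^ k))) 1) =
      Nat.card X * Nat.card Y := by
    rw [← hAB, hX, hY, hdual, ← h20]
    exact hEPC.symm
  -- clause 1: `Y ≤ X^⊥` (orthogonality, §2) and `#X^⊥ · #X = #H¹(M^D) = #X · #Y`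
  have hYle : Y ≤ annRight b X := fun y hy x hx =>
    localTatePairingZMod_eq_zero_of_mem_unramifiedSubgroup ρ (p ^ k) v _ hx hy
  have hcardR := natCard_annRight_mul hA b hbf X
  have hXpos : 0 < Nat.card X := Nat.card_pos
  have hR : annRight b X = Y := by
    symm
    refine AddSubgroup.eq_of_le_of_card_ge hYle (le_of_eq ?_)
    refine Nat.eq_of_mul_eq_mul_right hXpos ?_
    rw [hcardR, hkey, mul_comm]
  -- clause 2: `X ≤ {}^⊥Y` and `#{}^⊥Y · #Y = #H¹(M) = #X · #Y`
  have hXle : X ≤ annLeft b Y := fun x hx y hy =>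
    localTatePairingZMod_eq_zero_of_mem_unramifiedSubgroup ρ (p ^ k) v _ hx hy
  have hcardL := natCard_annLeft_mul hB b hb Y
  have hYpos : 0 < Nat.card Y := Nat.card_pos
  have hL : annLeft b Y = X := by
    symm
    refine AddSubgroup.eq_of_le_of_card_ge hXle (le_of_eq ?_)
    refine Nat.eq_of_mul_eq_mul_right hYpos ?_
    rw [hcardL, hAB, hkey]
  refine ⟨le_antisymm (fun y hy => ?_)
    (unramifiedSubgroup_tateDual_le_dualLocalCondition ρ (p ^ k) v inv), fun a ha => ?_⟩
  · have hy' : y ∈ annRight b X := fun x hx =>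
      (LocalInvariants.mem_dualLocalCondition_iff inv ρ (Sum.inr v) _ _).1 hy x hx
    rw [hR] at hy'
    exact hy'
  · have ha' : a ∈ annLeft b Y := fun y hy => ha y hy
    rw [hL] at ha'
    exact ha'

/-- **The unramified local condition is SELF-DUAL at every finite `v ∤ n`** (the form consumed by Selmer
structures): `(H¹_ur(K_v, M))^* = H¹_ur(K_v, M^D)` for every perfect family at prime-power `n` and every finite
`n`-torsion `M` — clause (1) of `dualLocalCondition_unramifiedSubgroup_eq`. [cite: MilneADT2006, Ch. I, Thm. 2.6] -/
theorem dualLocalCondition_unramifiedSubgroup (inv : LocalInvariants K n) (hn : IsPrimePow n)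
    (hperf : inv.IsPerfect) {M : Type u} [AddCommGroup M] [TopologicalSpace M] [DiscreteTopology M] [Finite M]
    (ρ : DiscreteGaloisModule K M) (hnM : ∀ m : M, n • m = 0)
    (v : HeightOneSpectrum (𝓞 K)) (hv : ((n : ℕ) : 𝓞 K) ∉ v.asIdeal) :
    inv.dualLocalCondition ρ (Sum.inr v)
        (DiscreteGaloisModule.unramifiedSubgroup (GaloisRep.toLocal v ρ) 1) =
      DiscreteGaloisModule.unramifiedSubgroup (GaloisRep.toLocal v (ρ.tateDual n)) 1 :=
  (dualLocalCondition_unramifiedSubgroup_eq inv hn hperf ρ hnM v hv).1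

/-- **A class annihilating `H¹_ur(K_v, M^D)` is unramified** (`v ∤ n`, perfect family, prime-power `n`, any
finite `n`-torsion `M`) — clause (2) of `dualLocalCondition_unramifiedSubgroup_eq`. [cite: MilneADT2006, Ch. I, Thm. 2.6] -/
theorem mem_unramifiedSubgroup_of_forall_pairing_eq_zero (inv : LocalInvariants K n) (hn : IsPrimePow n)
    (hperf : inv.IsPerfect) {M : Type u} [AddCommGroup M] [TopologicalSpace M] [DiscreteTopology M] [Finite M]
    (ρ : DiscreteGaloisModule K M) (hnM : ∀ m : M, n • m = 0)
    (v : HeightOneSpectrum (𝓞 K)) (hv : ((n : ℕ) : 𝓞 K) ∉ v.asIdeal)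
    {a : galoisCohomology (ρ.toLocal (Sum.inr v)) 1}
    (ha : ∀ b ∈ DiscreteGaloisModule.unramifiedSubgroup (GaloisRep.toLocal v (ρ.tateDual n)) 1,
      DiscreteGaloisModule.localTatePairingZMod ρ n (Sum.inr v) (inv (Sum.inr v)) a b = 0) :
    a ∈ DiscreteGaloisModule.unramifiedSubgroup (GaloisRep.toLocal v ρ) 1 :=
  (dualLocalCondition_unramifiedSubgroup_eq inv hn hperf ρ hnM v hv).2 a ha

end Main

end Summit.BirchSwinnertonDyer.BirchSwinnertonDyer.Theorems.UnramifiedSelfDual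

end
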